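import Mathlib
import Summits.AtomisticToContinuum.Crystallization.Theorems.ReggeStarCoercivityDefectFreeCrystallizesSqueezeToLayeredA
import Literature.MathematicalPhysics.StatisticalMechanics.TwoScaleShellSums
import HarnessLib

/-!
# Doors to the pinning charge (S2b) and to `SplitCoercivity` (S2a): localisation of the tail and the
internal-energy form of a slack-coercive charge — line `stacking-blind-budget-flatness`, crux
`ChessboardParticlePlanes.LjLaminarWindows` (stmt-AtomisticToContinuum-6711), lead a1

The two analytic stubs of the line, `stub_pinningCharge` (S2b) and `stub_splitCoercivity` (S2a =
`PrestressSplitKorn.SplitCoercivity`), share one shape: for a site predicate `P` ("charged sites"), for every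
separation `δ` a charge `c > 0`, and after every slack `θ > 0` a depth `ρ` and a boundary constant `C`, such
that for every `δ`-separated finite configuration `x` and every finite set `Ω` of sites with `ρ`-deep good
neighbourhoods
`c·#{i ∈ Ω : P i} − C·#{i ∈ Ω : within ρ of a particle outside Ω} − θ·#Ω ≤ Σ_{i∈Ω} (½𝓔ⁱ(x) − e*)`,
`e* = ⨅_Q e_LJ(Q)` the periodic infimum.  This file proves the two structural facts about that shape that every
certificate proof will use, with NO goodness hypothesis and NO unproved input:

* `cross_sum_ge` / `sum_half_siteEnergy_sub_eStar_ge` (**localisation of the tail; the budget-neutral case `c = 0`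
  is a THEOREM**): for every `δ > 0` and `θ > 0` there are `ρ > 0` and `C ≥ 0` with
  `−C·#∂_ρΩ − θ·#Ω ≤ Σ_{i∈Ω} (½𝓔ⁱ(x) − e*)` for EVERY `δ`-separated `x` and EVERY `Ω`.  Proof: split each site
  energy into the part internal to `Ω` and the cross part; the internal double sum is `≥ 2·#Ω·e*` by periodisation
  (`ChargedEnergyGapNegative.card_mul_eStar_le` applied to `x|_Ω`); the cross part of an interior site (all outside
  particles farther than `ρ`) is `≥ −(250/6)·δ⁻³ρ⁻³` by the two-scale shell sum
  (`sum_inv_pow_six_le_two_scale`, `V_LJ ≥ −r⁻⁶/6`), that of a boundary site is `≥ −(250/6)·δ⁻⁶`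
  (`sum_inv_pow_six_le`); choose `ρ` with `(250/12)·δ⁻³ρ⁻³ ≤ θ`.
* `slackCharge_of_internalCharge` (**the internal-energy door**): a charge certified on the INTERNAL excess of the
  block, `c·#{i ∈ Ω : P i} − C·#∂_ρΩ − θ·#Ω ≤ ½ Σ_{i∈Ω} Σ_{j∈Ω} V_LJ(|xᵢ − xⱼ|) − #Ω·E` for some reference level
  `E ≥ e*` (e.g. `E = hcpE a h`, the energy per particle of ANY homogeneous hcp configuration, by `iInf_le_hcpE`),
  implies the charge in the site-energy form above (depth `max`, constants added, slack doubled).  So S2b / S2a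
  may be proved as statements about finite clusters and an explicit reference energy, never mentioning `e*`.

Nothing here is specific to the pinned predicate; the skeleton instantiates `P`.
-/

noncomputable section

open scoped BigOperators Classical
open Filter Topology

namespace Summit.AtomisticToContinuum.Crystallization.Theorems.StackingBlindBudgetFlatness

open Literature.MathematicalPhysics.StatisticalMechanics Literature.Geometry.DiscreteGeometry
open Summit.AtomisticToContinuum.Crystallization.Theorems (ChargedEnergyGapNegative.eStar)
open Summit.AtomisticToContinuum.Crystallization.Theorems.PrestressSplitKorn
open Summit.AtomisticToContinuum.Crystallization.Theorems.DefectFreeCrystallizes.Negative.PredicateAPI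
  (Good)

variable {N : ℕ}

/-! ## Site energies split into the internal and the cross part -/

/-- With the junk value `V_LJ(0) = 0` the site energy is the full sum `Σ_j V(|xᵢ − xⱼ|)` (diagonal included). -/
theorem siteEnergy_eq_sum_univ (x : Fin N → EuclideanSpace ℝ (Fin 3)) (i : Fin N) :
    siteEnergy lennardJones x i = ∑ j, lennardJones (dist (x i) (x j)) := by
  unfold siteEnergy
  rw [← Finset.add_sum_erase Finset.univ (fun j => lennardJones (dist (x i) (x j))) (Finset.mem_univ i)]
  simp [lennardJones_zero]

/-- Internal / cross splitting of the summed site energies of a block `Ω`. -/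
theorem sum_siteEnergy_eq_internal_add_cross (x : Fin N → EuclideanSpace ℝ (Fin 3)) (Ω : Finset (Fin N)) :
    ∑ i ∈ Ω, siteEnergy lennardJones x i =
      (∑ i ∈ Ω, ∑ j ∈ Ω, lennardJones (dist (x i) (x j))) +
        ∑ i ∈ Ω, ∑ j ∈ Ωᶜ, lennardJones (dist (x i) (x j)) := by
  rw [← Finset.sum_add_distrib]
  refine Finset.sum_congr rfl fun i _ => ?_
  rw [siteEnergy_eq_sum_univ, ← Finset.sum_add_sum_compl Ω]

/-- **Periodisation of the block**: the internal double sum of `Ω` is at least `2·#Ω·e*`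
(`card_mul_eStar_le` for the restricted configuration `x|_Ω`). -/
theorem two_mul_card_mul_eStar_le_internal {δ : ℝ} (hδ : 0 < δ) {x : Fin N → EuclideanSpace ℝ (Fin 3)}
    (hsep : ∀ i j : Fin N, i ≠ j → δ ≤ dist (x i) (x j)) (Ω : Finset (Fin N)) :
    2 * ((Ω.card : ℝ) * ChargedEnergyGapNegative.eStar) ≤
      ∑ i ∈ Ω, ∑ j ∈ Ω, lennardJones (dist (x i) (x j)) := by
  -- enumerate `Ω`
  set e : Fin Ω.card ≃ Ω := Ω.equivFin.symm with he
  set y : Fin Ω.card → EuclideanSpace ℝ (Fin 3) := fun k => x (e k) with hy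
  have hxinj : Function.Injective x := squeeze_injective_of_separated hδ hsep
  have hyinj : Function.Injective y := by
    intro k k' h
    have h1 : (e k : Fin N) = e k' := hxinj h
    exact e.injective (Subtype.ext h1)
  have h1 := ChargedEnergyGapNegative.card_mul_eStar_le hyinj
  have h2 := two_mul_interactionEnergy lennardJones y
  -- `Σ_k 𝓔ᵏ(y) = Σ_{i∈Ω} Σ_{j∈Ω} V`
  have h3 : ∑ k, siteEnergy lennardJones y k = ∑ i ∈ Ω, ∑ j ∈ Ω, lennardJones (dist (x i) (x j)) := by
    have inner : ∀ k, siteEnergy lennardJones y k = ∑ j ∈ Ω, lennardJones (dist (y k) (x j)) := by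
      intro k
      rw [siteEnergy_eq_sum_univ]
      have := Fintype.sum_equiv e (fun k' => lennardJones (dist (y k) (y k')))
        (fun j : Ω => lennardJones (dist (y k) (x j))) (fun k' => rfl)
      rw [this, Finset.sum_coe_sort Ω (fun j => lennardJones (dist (y k) (x j)))]
    simp_rw [inner]
    have := Fintype.sum_equiv e (fun k => ∑ j ∈ Ω, lennardJones (dist (y k) (x j)))
      (fun i : Ω => ∑ j ∈ Ω, lennardJones (dist (x i) (x j))) (fun k => rfl)
    rw [this, Finset.sum_coe_sort Ω (fun i => ∑ j ∈ Ω, lennardJones (dist (x i) (x j)))]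
  have h4 : (Fintype.card (Fin Ω.card) : ℝ) = Ω.card := by rw [Fintype.card_fin]
  have h1' : (Ω.card : ℝ) * ChargedEnergyGapNegative.eStar ≤ interactionEnergy lennardJones y := by
    simpa using h1
  linarith

/-! ## The cross part: shell sums -/

/-- **Cross part of a boundary site**: `Σ_{j ∉ Ω} V(|xᵢ − xⱼ|) ≥ −(250/6)·δ⁻⁶` (`i ∈ Ω`, full shell sum). -/
theorem cross_site_ge_boundary {δ : ℝ} (hδ : 0 < δ) {x : Fin N → EuclideanSpace ℝ (Fin 3)}
    (hsep : ∀ i j : Fin N, i ≠ j → δ ≤ dist (x i) (x j)) {Ω : Finset (Fin N)} {i : Fin N} (hi : i ∈ Ω) :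
    -(250 / 6 * δ⁻¹ ^ 6) ≤ ∑ j ∈ Ωᶜ, lennardJones (dist (x i) (x j)) := by
  have hS := sum_inv_pow_six_le x hδ hsep i
  have hsub : Ωᶜ ⊆ Finset.univ.erase i := by
    intro j hj
    rw [Finset.mem_compl] at hj
    exact Finset.mem_erase.2 ⟨fun h => hj (h ▸ hi), Finset.mem_univ _⟩
  have hle : ∑ j ∈ Ωᶜ, (dist (x i) (x j))⁻¹ ^ 6 ≤ ∑ j ∈ Finset.univ.erase i, (dist (x i) (x j))⁻¹ ^ 6 :=
    Finset.sum_le_sum_of_subset_of_nonneg hsub fun j _ _ => by positivity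
  have h1 : ∑ j ∈ Ωᶜ, -(1 / 6 * (dist (x i) (x j))⁻¹ ^ 6) ≤ ∑ j ∈ Ωᶜ, lennardJones (dist (x i) (x j)) :=
    Finset.sum_le_sum fun j _ => squeeze_neg_inv_pow_six_le_lennardJones _
  rw [Finset.sum_neg_distrib, ← Finset.mul_sum] at h1
  linarith

/-- **Cross part of an interior site**: if every particle outside `Ω` is farther than `ρ ≥ δ` from `xᵢ`, then
`Σ_{j ∉ Ω} V(|xᵢ − xⱼ|) ≥ −(250/6)·δ⁻³·ρ⁻³` (two-scale shell sum). -/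
theorem cross_site_ge_interior {δ ρ : ℝ} (hδ : 0 < δ) (hδρ : δ ≤ ρ) {x : Fin N → EuclideanSpace ℝ (Fin 3)}
    (hsep : ∀ i j : Fin N, i ≠ j → δ ≤ dist (x i) (x j)) {Ω : Finset (Fin N)} {i : Fin N}
    (hfar : ∀ j : Fin N, j ∉ Ω → ρ ≤ dist (x j) (x i)) :
    -(250 / 6 * δ⁻¹ ^ 3 * ρ⁻¹ ^ 3) ≤ ∑ j ∈ Ωᶜ, lennardJones (dist (x i) (x j)) := by
  have hxinj : Function.Injective x := squeeze_injective_of_separated hδ hsep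
  have hρ : 0 < ρ := hδ.trans_le hδρ
  set t : Finset (EuclideanSpace ℝ (Fin 3)) := Ωᶜ.image x with ht
  have hts : ∀ z ∈ t, ∀ w ∈ t, z ≠ w → δ ≤ dist z w := by
    intro z hz w hw hzw
    obtain ⟨j, -, rfl⟩ := Finset.mem_image.1 hz
    obtain ⟨k, -, rfl⟩ := Finset.mem_image.1 hw
    exact hsep j k fun h => hzw (h ▸ rfl)
  have htp : ∀ z ∈ t, ρ ≤ dist (x i) z := by
    intro z hz
    obtain ⟨j, hj, rfl⟩ := Finset.mem_image.1 hz
    rw [dist_comm]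
    exact hfar j (Finset.mem_compl.1 hj)
  have hS := sum_inv_pow_six_le_two_scale t (x i) hδ hδρ hts htp
  have himg : ∑ z ∈ t, (dist (x i) z)⁻¹ ^ 6 = ∑ j ∈ Ωᶜ, (dist (x i) (x j))⁻¹ ^ 6 := by
    rw [ht, Finset.sum_image fun j _ k _ h => hxinj h]
  rw [himg] at hS
  have h1 : ∑ j ∈ Ωᶜ, -(1 / 6 * (dist (x i) (x j))⁻¹ ^ 6) ≤ ∑ j ∈ Ωᶜ, lennardJones (dist (x i) (x j)) :=
    Finset.sum_le_sum fun j _ => squeeze_neg_inv_pow_six_le_lennardJones _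
  rw [Finset.sum_neg_distrib, ← Finset.mul_sum] at h1
  have h0 : (0 : ℝ) ≤ δ⁻¹ ^ 3 * ρ⁻¹ ^ 3 := by positivity
  nlinarith

/-- **The cross part of a block**: with `∂_ρΩ = {i ∈ Ω : some particle outside Ω is within ρ of xᵢ}`,
`Σ_{i∈Ω} Σ_{j∉Ω} V(|xᵢ − xⱼ|) ≥ −(250/6)·δ⁻⁶·#∂_ρΩ − (250/6)·δ⁻³ρ⁻³·#Ω`. -/
theorem cross_sum_ge {δ ρ : ℝ} (hδ : 0 < δ) (hδρ : δ ≤ ρ) {x : Fin N → EuclideanSpace ℝ (Fin 3)}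
    (hsep : ∀ i j : Fin N, i ≠ j → δ ≤ dist (x i) (x j)) (Ω : Finset (Fin N)) :
    -(250 / 6 * δ⁻¹ ^ 6) * ((Ω.filter fun i => ∃ j : Fin N, j ∉ Ω ∧ dist (x j) (x i) ≤ ρ).card : ℝ)
        - (250 / 6 * δ⁻¹ ^ 3 * ρ⁻¹ ^ 3) * (Ω.card : ℝ)
      ≤ ∑ i ∈ Ω, ∑ j ∈ Ωᶜ, lennardJones (dist (x i) (x j)) := by
  have hρ : 0 < ρ := hδ.trans_le hδρ
  set B := Ω.filter fun i => ∃ j : Fin N, j ∉ Ω ∧ dist (x j) (x i) ≤ ρ with hB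
  set K₁ : ℝ := 250 / 6 * δ⁻¹ ^ 6 with hK₁
  set K₂ : ℝ := 250 / 6 * δ⁻¹ ^ 3 * ρ⁻¹ ^ 3 with hK₂
  have hK₁0 : 0 ≤ K₁ := by positivity
  have hK₂0 : 0 ≤ K₂ := by positivity
  -- sitewise lower bound by an indicator
  have hsite : ∀ i ∈ Ω, -(K₁ * (if i ∈ B then 1 else 0) + K₂) ≤ ∑ j ∈ Ωᶜ, lennardJones (dist (x i) (x j)) := by
    intro i hi
    by_cases hb : i ∈ B
    · rw [if_pos hb, mul_one]
      have := cross_site_ge_boundary hδ hsep hi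
      linarith
    · rw [if_neg hb, mul_zero, zero_add]
      have hfar : ∀ j : Fin N, j ∉ Ω → ρ ≤ dist (x j) (x i) := by
        intro j hj
        by_contra hlt
        exact hb (Finset.mem_filter.2 ⟨hi, j, hj, (not_le.1 hlt).le⟩)
      have := cross_site_ge_interior hδ hδρ hsep hfar
      linarith
  have hsum := Finset.sum_le_sum hsite
  have hind : ∑ i ∈ Ω, (if i ∈ B then (1 : ℝ) else 0) = B.card := by
    rw [Finset.sum_boole, Finset.filter_mem_eq_inter, Finset.inter_eq_right.2 (Finset.filter_subset _ _)]
  have hre : ∑ i ∈ Ω, -(K₁ * (if i ∈ B then (1 : ℝ) else 0) + K₂) = -(K₁ * B.card) - K₂ * Ω.card := by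
    rw [Finset.sum_neg_distrib, Finset.sum_add_distrib, ← Finset.mul_sum, hind, Finset.sum_const, nsmul_eq_mul]
    ring
  rw [hre] at hsum
  linarith

/-! ## Door 1: localisation of the tail (the budget-neutral slack-coercivity inequality) -/

/-- **The summed excess of a block is bounded below by boundary and slack, for EVERY block of EVERY separated
configuration.** For `δ > 0`, `θ > 0` there are `ρ > 0` and `C ≥ 0` such that for every `δ`-separated finite
`x` and every finite set `Ω` of sites,
`−C·#{i ∈ Ω : within ρ of a particle outside Ω} − θ·#Ω ≤ Σ_{i∈Ω} (½𝓔ⁱ(x) − ⨅_Q e(Q))`.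
This is the `c = 0` case of the slack-coercivity shape of S2a / S2b (no goodness needed): periodisation of
`x|_Ω` for the internal part, two-scale shell sums for the cross part. -/
theorem sum_half_siteEnergy_sub_eStar_ge {δ : ℝ} (hδ : 0 < δ) {θ : ℝ} (hθ : 0 < θ) :
    ∃ ρ C : ℝ, 0 < ρ ∧ 0 ≤ C ∧
      ∀ (N : ℕ) (x : Fin N → EuclideanSpace ℝ (Fin 3)), (∀ i j : Fin N, i ≠ j → δ ≤ dist (x i) (x j)) →
      ∀ Ω : Finset (Fin N),
        -(C * ((Ω.filter fun i => ∃ j : Fin N, j ∉ Ω ∧ dist (x j) (x i) ≤ ρ).card : ℝ)) - θ * (Ω.card : ℝ)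
          ≤ ∑ i ∈ Ω, ((1 / 2 : ℝ) * siteEnergy lennardJones x i -
              ⨅ Q : PeriodicConfiguration 3, Q.energyPerParticle lennardJones) := by
  -- constants
  set K : ℝ := 250 / 12 * δ⁻¹ ^ 3 with hK
  have hKpos : 0 < K := by positivity
  set ρ : ℝ := max δ (max 1 (K / θ)) with hρ
  have hδρ : δ ≤ ρ := le_max_left _ _
  have hρ1 : 1 ≤ ρ := (le_max_left _ _).trans (le_max_right _ _)
  have hρK : K / θ ≤ ρ := (le_max_right _ _).trans (le_max_right _ _)
  have hρpos : 0 < ρ := hδ.trans_le hδρ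
  refine ⟨ρ, 250 / 12 * δ⁻¹ ^ 6, hρpos, by positivity, fun N x hsep Ω => ?_⟩
  -- slack: `(250/12) δ⁻³ ρ⁻³ ≤ θ`
  have hslack : 250 / 12 * δ⁻¹ ^ 3 * ρ⁻¹ ^ 3 ≤ θ := by
    have h1 : ρ⁻¹ ^ 3 ≤ ρ⁻¹ := by
      have hρi1 : ρ⁻¹ ≤ 1 := inv_le_one_of_one_le₀ hρ1
      have hρi0 : 0 ≤ ρ⁻¹ := by positivity
      calc ρ⁻¹ ^ 3 = ρ⁻¹ * (ρ⁻¹ * ρ⁻¹) := by ring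
        _ ≤ ρ⁻¹ * (1 * 1) := by gcongr
        _ = ρ⁻¹ := by ring
    have h2 : K * ρ⁻¹ ≤ θ := by
      rw [div_le_iff₀ hθ] at hρK
      calc K * ρ⁻¹ ≤ (ρ * θ) * ρ⁻¹ := mul_le_mul_of_nonneg_right hρK (by positivity)
        _ = θ := by field_simp
    calc 250 / 12 * δ⁻¹ ^ 3 * ρ⁻¹ ^ 3 = K * ρ⁻¹ ^ 3 := by rw [hK]
      _ ≤ K * ρ⁻¹ := mul_le_mul_of_nonneg_left h1 hKpos.le
      _ ≤ θ := h2
  -- assemble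
  have hint := two_mul_card_mul_eStar_le_internal hδ hsep Ω
  have hcross := cross_sum_ge hδ hδρ hsep Ω
  have hsplit := sum_siteEnergy_eq_internal_add_cross x Ω
  rw [Finset.sum_sub_distrib, Finset.sum_const, nsmul_eq_mul, squeeze_iInf_eq_eStar, ← Finset.mul_sum, hsplit]
  have hΩ0 : (0 : ℝ) ≤ Ω.card := by positivity
  have hB0 : (0 : ℝ) ≤ ((Ω.filter fun i => ∃ j : Fin N, j ∉ Ω ∧ dist (x j) (x i) ≤ ρ).card : ℝ) := by
    positivity
  nlinarith [mul_le_mul_of_nonneg_right hslack hΩ0]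

/-! ## Door 2: a charge on the internal energy of the block is a charge on its summed site energies -/

/-- **The internal-energy door.** Let `P` be any site predicate and `E` any reference level with `⨅_Q e(Q) ≤ E`
(for instance `E = hcpE a h`, the energy per particle of a homogeneous hcp configuration, `iInf_le_hcpE`). If the
charge is certified on the INTERNAL excess of blocks — `c·#{i ∈ Ω : P i} − C·#∂_ρΩ − θ·#Ω ≤
½·Σ_{i∈Ω}Σ_{j∈Ω} V_LJ(|xᵢ − xⱼ|) − #Ω·E` for `δ`-separated `x` and hypothesis-`H` blocks `Ω` (any side condition
`H`, e.g. `ρ`-deep goodness, monotone in `ρ`) — then it holds in the site-energy form of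
`SplitCoercivity` / the pinning charge, with the periodic infimum: same charge `c`, slack `2θ`, a larger depth and
boundary constant. -/
theorem slackCharge_of_internalCharge {δ : ℝ} (hδ : 0 < δ)
    (P : (N : ℕ) → (Fin N → EuclideanSpace ℝ (Fin 3)) → Fin N → Prop)
    (H : (N : ℕ) → (Fin N → EuclideanSpace ℝ (Fin 3)) → Finset (Fin N) → ℝ → Prop)
    (hH : ∀ (N : ℕ) (x : Fin N → EuclideanSpace ℝ (Fin 3)) (Ω : Finset (Fin N)) (ρ ρ' : ℝ),
      ρ ≤ ρ' → H N x Ω ρ' → H N x Ω ρ)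
    {E : ℝ} (hE : (⨅ Q : PeriodicConfiguration 3, Q.energyPerParticle lennardJones) ≤ E)
    {c θ ρ C : ℝ} (hθ : 0 < θ) (hρ : 0 < ρ)
    (hint : ∀ (N : ℕ) (x : Fin N → EuclideanSpace ℝ (Fin 3)), (∀ i j : Fin N, i ≠ j → δ ≤ dist (x i) (x j)) →
      ∀ Ω : Finset (Fin N), H N x Ω ρ →
        c * ((Ω.filter fun i => P N x i).card : ℝ)
            - C * ((Ω.filter fun i => ∃ j : Fin N, j ∉ Ω ∧ dist (x j) (x i) ≤ ρ).card : ℝ)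
            - θ * (Ω.card : ℝ)
          ≤ (1 / 2 : ℝ) * (∑ i ∈ Ω, ∑ j ∈ Ω, lennardJones (dist (x i) (x j))) - (Ω.card : ℝ) * E) :
    ∃ ρ' C' : ℝ, 0 < ρ' ∧
      ∀ (N : ℕ) (x : Fin N → EuclideanSpace ℝ (Fin 3)), (∀ i j : Fin N, i ≠ j → δ ≤ dist (x i) (x j)) →
      ∀ Ω : Finset (Fin N), H N x Ω ρ' →
        c * ((Ω.filter fun i => P N x i).card : ℝ)
            - C' * ((Ω.filter fun i => ∃ j : Fin N, j ∉ Ω ∧ dist (x j) (x i) ≤ ρ').card : ℝ)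
            - (2 * θ) * (Ω.card : ℝ)
          ≤ ∑ i ∈ Ω, ((1 / 2 : ℝ) * siteEnergy lennardJones x i -
              ⨅ Q : PeriodicConfiguration 3, Q.energyPerParticle lennardJones) := by
  -- the cross part at slack `θ`
  set K : ℝ := 250 / 12 * δ⁻¹ ^ 3 with hK
  have hKpos : 0 < K := by positivity
  set ρ' : ℝ := max ρ (max δ (max 1 (K / θ))) with hρ'
  have hρρ' : ρ ≤ ρ' := le_max_left _ _
  have hδρ' : δ ≤ ρ' := (le_max_left _ _).trans (le_max_right _ _)
  have hρ'1 : 1 ≤ ρ' := ((le_max_left _ _).trans (le_max_right _ _)).trans (le_max_right _ _)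
  have hρ'K : K / θ ≤ ρ' := ((le_max_right _ _).trans (le_max_right _ _)).trans (le_max_right _ _)
  have hρ'pos : 0 < ρ' := hρ.trans_le hρρ'
  refine ⟨ρ', max C 0 + 250 / 12 * δ⁻¹ ^ 6, hρ'pos, fun N x hsep Ω hΩ => ?_⟩
  have hslack : 250 / 12 * δ⁻¹ ^ 3 * ρ'⁻¹ ^ 3 ≤ θ := by
    have h1 : ρ'⁻¹ ^ 3 ≤ ρ'⁻¹ := by
      have hρi1 : ρ'⁻¹ ≤ 1 := inv_le_one_of_one_le₀ hρ'1
      have hρi0 : 0 ≤ ρ'⁻¹ := by positivity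
      calc ρ'⁻¹ ^ 3 = ρ'⁻¹ * (ρ'⁻¹ * ρ'⁻¹) := by ring
        _ ≤ ρ'⁻¹ * (1 * 1) := by gcongr
        _ = ρ'⁻¹ := by ring
    have h2 : K * ρ'⁻¹ ≤ θ := by
      rw [div_le_iff₀ hθ] at hρ'K
      calc K * ρ'⁻¹ ≤ (ρ' * θ) * ρ'⁻¹ := mul_le_mul_of_nonneg_right hρ'K (by positivity)
        _ = θ := by field_simp
    calc 250 / 12 * δ⁻¹ ^ 3 * ρ'⁻¹ ^ 3 = K * ρ'⁻¹ ^ 3 := by rw [hK]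
      _ ≤ K * ρ'⁻¹ := mul_le_mul_of_nonneg_left h1 hKpos.le
      _ ≤ θ := h2
  -- the internal charge at depth `ρ` (from `H` at depth `ρ'`)
  have hI := hint N x hsep Ω (hH N x Ω ρ ρ' hρρ' hΩ)
  have hcross := cross_sum_ge hδ hδρ' hsep Ω
  have hsplit := sum_siteEnergy_eq_internal_add_cross x Ω
  -- boundary sets are monotone in the depth
  set B := (Ω.filter fun i => ∃ j : Fin N, j ∉ Ω ∧ dist (x j) (x i) ≤ ρ) with hB
  set B' := (Ω.filter fun i => ∃ j : Fin N, j ∉ Ω ∧ dist (x j) (x i) ≤ ρ') with hB'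
  have hBB' : (B.card : ℝ) ≤ B'.card := by
    have hsub : B ⊆ B' := by
      intro i hi
      obtain ⟨hiΩ, j, hj, hd⟩ := Finset.mem_filter.1 hi
      exact Finset.mem_filter.2 ⟨hiΩ, j, hj, hd.trans hρρ'⟩
    exact_mod_cast Finset.card_le_card hsub
  have hCB : C * (B.card : ℝ) ≤ max C 0 * B'.card :=
    calc C * (B.card : ℝ) ≤ max C 0 * B.card := mul_le_mul_of_nonneg_right (le_max_left _ _) (by positivity)
      _ ≤ max C 0 * B'.card := mul_le_mul_of_nonneg_left hBB' (le_max_right _ _)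
  -- reference level
  have hΩ0 : (0 : ℝ) ≤ Ω.card := by positivity
  have hEΩ : (Ω.card : ℝ) * (⨅ Q : PeriodicConfiguration 3, Q.energyPerParticle lennardJones) ≤
      (Ω.card : ℝ) * E := mul_le_mul_of_nonneg_left hE hΩ0
  rw [Finset.sum_sub_distrib, Finset.sum_const, nsmul_eq_mul, ← Finset.mul_sum, hsplit]
  have hB'0 : (0 : ℝ) ≤ B'.card := by positivity
  nlinarith [mul_le_mul_of_nonneg_right hslack hΩ0]

/-- Landing anchor of this file (registered sub-goal of crux stmt-AtomisticToContinuum-6711, line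
`stacking-blind-budget-flatness`; it is Door 1 `sum_half_siteEnergy_sub_eStar_ge` restated verbatim): the
budget-neutral slack-coercivity inequality holds for every block of every separated configuration. -/
theorem pinningChargeDoors_anchor :
    ∀ δ : ℝ, 0 < δ → ∀ θ : ℝ, 0 < θ → ∃ ρ C : ℝ, 0 < ρ ∧ 0 ≤ C ∧
      ∀ (N : ℕ) (x : Fin N → EuclideanSpace ℝ (Fin 3)), (∀ i j : Fin N, i ≠ j → δ ≤ dist (x i) (x j)) →
      ∀ Ω : Finset (Fin N),
        -(C * ((Ω.filter fun i => ∃ j : Fin N, j ∉ Ω ∧ dist (x j) (x i) ≤ ρ).card : ℝ)) - θ * (Ω.card : ℝ)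
          ≤ ∑ i ∈ Ω, ((1 / 2 : ℝ) * siteEnergy lennardJones x i -
              ⨅ Q : PeriodicConfiguration 3, Q.energyPerParticle lennardJones) :=
  fun _ hδ _ hθ => sum_half_siteEnergy_sub_eStar_ge hδ hθ

end Summit.AtomisticToContinuum.Crystallization.Theorems.StackingBlindBudgetFlatness

end
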